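import Summits.QuantumFields.YangMills.Theorems.CentreWallReflectionSlabGluing
import HarnessLib

/-!
# Slab decomposition of the four-torus Wilson weight, III: the slab kernels and the ring identities
# (crux `CentreWallReflection.WallReflection` ⟨stmt-QuantumFields-23707⟩, line `birth`, stub `stub_instantiate`; planner ym-idea-4 g18)

The slab kernels `Ψ_j(X,A) = ∫ exp(−β S_{[0,j]}(glue_j(U;X,A))) dπ(U)` are measurable and `[0,1]`-valued; the complementary slab integrates to
`Ψ_{n+1−j}(A,X)` (translation); RING IDENTITIES: for an insertion `H` reading only slices `0` and `j`,
`∫ H e^{−βΣc} dπ = ∫dX∫dA Hb(X,A) Ψ_j(X,A) Ψ_{n+1−j}(A,X)` and, with the twist `T`, `∫ H e^{−βΣc^z} dπ = ∫dX∫dA Hb(TX,A) Ψ_j(X,A) Ψ_{n+1−j}(A,TX)`.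
HONEST FRAMING: lattice bookkeeping toward ONE crux of a draft route (fixed torus, finite lattice); nothing here proves the route's target
`MarginalTwistOnset.FixedTorusCriterionFailure`, any continuum statement, or the Yang–Mills mass gap.  THEOREMS ONLY (no `def`, no `sorry`),
standard axioms.  References: [cite: OsterwalderSeiler1978, §2]; [cite: tHooft1979]; E. T. Tomboulis, L. G. Yaffe, CMP 100 (1985) 313;
[cite: Luscher1983, §2].
-/

set_option autoImplicit false

noncomputable section

open scoped BigOperators
open MeasureTheory Literature.MathematicalPhysics.QuantumFieldTheory

namespace Summit.QuantumFields.YangMills.Theorems.CentreWallReflection.Slab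

open MeasureTheory
open Literature.MathematicalPhysics.QuantumFieldTheory.LatticeRP (splice measurePreserving_splice measurable_splice)

section MeasureCore

variable {n : ℕ} {G : Type*} [Group G] [TopologicalSpace G] [IsTopologicalGroup G] [CompactSpace G]
  [MeasurableSpace G] [BorelSpace G] {N : ℕ} (ρ : G →* Matrix (Fin N) (Fin N) ℂ) (μ : Fin 4)

local notation "Ω" => GaugeConfig 4 (n + 1) G
local notation "πH" => (MeasureTheory.Measure.pi (fun _ : Edge 4 (n + 1) => haarProbability G))

/-! ## §7 Change of variables, splices, gluing -/

omit [TopologicalSpace G] [IsTopologicalGroup G] [CompactSpace G] [BorelSpace G] in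
/-- Change of variables along a measure-preserving map (real integrand, no embedding hypothesis). -/
theorem integral_comp_mp {X Y : Type*} [MeasurableSpace X] [MeasurableSpace Y] {μ₁ : Measure X} {μ₂ : Measure Y} {T : X → Y}
    (hT : MeasurePreserving T μ₁ μ₂) {Φ : Y → ℝ} (hΦ : Measurable Φ) : ∫ x, Φ (T x) ∂μ₁ = ∫ y, Φ y ∂μ₂ := by
  rw [← integral_map hT.measurable.aemeasurable hΦ.aestronglyMeasurable, hT.map_eq]

/-- Translation preserves the product Haar measure. -/
theorem measurePreserving_translate (j : ZMod (n + 1)) : MeasurePreserving (translate (G := G) μ j) πH πH := by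
  have h := measurePreserving_arrowCongr' (fun _ : Edge 4 (n + 1) => haarProbability G) (fun _ => haarProbability G)
    (edgeShift μ j).symm (MeasurableEquiv.refl G) (fun _ => MeasurePreserving.id _)
  have heq : (translate (G := G) μ j) = ⇑(MeasurableEquiv.arrowCongr' (edgeShift (n := n) μ j).symm (MeasurableEquiv.refl G)) := by
    funext W e; rfl
  rw [heq]; exact h

/-- The centre twist (left multiplication by constants on some links) preserves the product Haar measure. -/
theorem measurePreserving_twistMap (ν : Fin 4) (z : G) : MeasurePreserving (twistMap (n := n) μ ν z) πH πH := by
  have h := measurePreserving_pi (fun _ : Edge 4 (n + 1) => haarProbability G) (fun _ => haarProbability G)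
    (f := fun e (g : G) => stackConfig (n := n) μ ν z e * g) (fun e => measurePreserving_mul_left (haarProbability G) _)
  exact h

omit [Group G] [TopologicalSpace G] [IsTopologicalGroup G] [CompactSpace G] [MeasurableSpace G] [BorelSpace G] in
/-- Gluing in terms of two coordinate splices. -/
theorem glue_eq_splice (j : ℕ) (U X A : Ω) :
    glue μ j U X A = splice (sliceEdges μ 0) (splice (sliceEdges μ (j : ZMod (n + 1))) (U, translate μ (-(j : ZMod (n + 1))) A), X) := by
  funext e
  simp only [Literature.MathematicalPhysics.QuantumFieldTheory.LatticeRP.splice_apply, mem_sliceEdges, translate_apply, Pi.single_neg,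
    ← sub_eq_add_neg]
  rfl

omit [Group G] [TopologicalSpace G] [IsTopologicalGroup G] [CompactSpace G] [BorelSpace G] in
/-- `integrable_of_bdd` (slab bookkeeping, see the module docstring). -/
theorem integrable_of_bdd {f : Ω → ℝ} (hf : Measurable f) {C : ℝ} (hC : ∀ W, |f W| ≤ C) (ν : Measure Ω) [IsFiniteMeasure ν] :
    Integrable f ν :=
  Integrable.of_bound hf.aestronglyMeasurable C (ae_of_all _ fun W => by rw [Real.norm_eq_abs]; exact hC W)

/-- Splitting an integral along a coordinate splice. -/
theorem integral_splice (C : Finset (Edge 4 (n + 1))) {F : Ω → ℝ} (hF : Measurable F) {K : ℝ} (hFb : ∀ W, |F W| ≤ K) :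
    ∫ W, F W ∂πH = ∫ U, ∫ Y, F (splice C (U, Y)) ∂πH ∂πH := by
  have hmp := measurePreserving_splice (haarProbability G) C
  rw [← integral_comp_mp hmp hF]
  have hint : Integrable (fun p : Ω × Ω => F (splice C p)) ((πH).prod πH) :=
    Integrable.of_bound ((hF.comp (measurable_splice C)).aestronglyMeasurable) K
      (ae_of_all _ fun p => by rw [Real.norm_eq_abs]; exact hFb _)
  rw [integral_prod _ hint]

omit [Group G] [TopologicalSpace G] [IsTopologicalGroup G] [CompactSpace G] [BorelSpace G] in
/-- Gluing is measurable in all three arguments. -/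
theorem measurable_glue₃ (j : ℕ) : Measurable fun p : Ω × Ω × Ω => glue μ j p.1 p.2.1 p.2.2 := by
  refine measurable_pi_lambda _ fun e => ?_
  unfold glue
  split_ifs
  · exact (measurable_pi_apply e).comp (measurable_fst.comp measurable_snd)
  · exact (measurable_pi_apply _).comp (measurable_snd.comp measurable_snd)
  · exact (measurable_pi_apply e).comp measurable_fst

omit [Group G] [TopologicalSpace G] [IsTopologicalGroup G] [CompactSpace G] [BorelSpace G] in
/-- `measurable_glue_left` (slab bookkeeping, see the module docstring). -/
theorem measurable_glue_left (j : ℕ) (X A : Ω) : Measurable fun U : Ω => glue μ j U X A :=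
  (measurable_glue₃ μ j).comp (measurable_id.prodMk (measurable_const.prodMk measurable_const))

/-- **Gluing formula**: `∫ F dπ = ∫dX ∫dA ∫dU F(glue U X A)`. -/
theorem integral_glue (j : ℕ) {F : Ω → ℝ} (hF : Measurable F) {K : ℝ} (hFb : ∀ W, |F W| ≤ K) :
    ∫ W, F W ∂πH = ∫ X, ∫ A, ∫ U, F (glue μ j U X A) ∂πH ∂πH ∂πH := by
  -- first splice: slice 0
  rw [integral_splice (sliceEdges μ 0) hF hFb]
  have h1 : Integrable (Function.uncurry fun (U X : Ω) => F (splice (sliceEdges μ 0) (U, X))) ((πH).prod πH) :=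
    Integrable.of_bound ((hF.comp (measurable_splice _)).aestronglyMeasurable) K
      (ae_of_all _ fun p => by rw [Real.norm_eq_abs]; exact hFb _)
  rw [integral_integral_swap h1]
  refine integral_congr_ae (ae_of_all _ fun X => ?_)
  dsimp only
  -- second splice: slice j
  have hGm : Measurable fun V : Ω => F (splice (sliceEdges μ 0) (V, X)) :=
    hF.comp ((measurable_splice _).comp (measurable_id.prodMk measurable_const))
  rw [integral_splice (sliceEdges μ (j : ZMod (n + 1))) hGm (fun W => hFb _)]
  have h2 : Integrable (Function.uncurry fun (U B : Ω) =>
      F (splice (sliceEdges μ 0) (splice (sliceEdges μ (j : ZMod (n + 1))) (U, B), X))) ((πH).prod πH) :=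
    Integrable.of_bound ((hGm.comp (measurable_splice _)).aestronglyMeasurable) K
      (ae_of_all _ fun p => by rw [Real.norm_eq_abs]; exact hFb _)
  rw [integral_integral_swap h2]
  -- translate the slice-j variable
  have hm2 : Measurable (Function.uncurry fun (B U : Ω) =>
      F (splice (sliceEdges μ 0) (splice (sliceEdges μ (j : ZMod (n + 1))) (U, B), X))) :=
    hGm.comp ((measurable_splice _).comp (measurable_snd.prodMk measurable_fst))
  have hm : Measurable (fun B : Ω =>
      ∫ U, F (splice (sliceEdges μ 0) (splice (sliceEdges μ (j : ZMod (n + 1))) (U, B), X)) ∂πH) :=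
    (hm2.stronglyMeasurable.integral_prod_right' (ν := πH)).measurable
  have h4 : (∫ A, ∫ U, F (splice (sliceEdges μ 0) (splice (sliceEdges μ (j : ZMod (n + 1)))
      (U, translate μ (-(j : ZMod (n + 1))) A), X)) ∂πH ∂πH) =
      ∫ B, ∫ U, F (splice (sliceEdges μ 0) (splice (sliceEdges μ (j : ZMod (n + 1))) (U, B), X)) ∂πH ∂πH :=
    integral_comp_mp (measurePreserving_translate μ (-(j : ZMod (n + 1)))) hm
  simp only [glue_eq_splice]
  exact h4.symm

/-- Independence of disjoint link blocks (real version). -/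
theorem integral_mul_of_dependsOn (S T : Finset (Edge 4 (n + 1))) (hST : Disjoint S T) {f g : Ω → ℝ}
    (hf : Measurable f) (hg : Measurable g) (hfS : DependsOn f (S : Set (Edge 4 (n + 1)))) (hgT : DependsOn g (T : Set (Edge 4 (n + 1)))) :
    ∫ U, f U * g U ∂πH = (∫ U, f U ∂πH) * ∫ U, g U ∂πH := by
  have h := Literature.MathematicalPhysics.QuantumFieldTheory.LatticeRP.integral_mul_eq_of_dependsOn (haarProbability G) S T hST
    (f := fun U => (f U : ℂ)) (g := fun U => (g U : ℂ)) (Complex.measurable_ofReal.comp hf) (Complex.measurable_ofReal.comp hg)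
    (fun U V hUV => by simp only [hfS hUV]) (fun U V hUV => by simp only [hgT hUV])
  simp only [← Complex.ofReal_mul] at h
  rw [integral_complex_ofReal, integral_complex_ofReal, integral_complex_ofReal] at h
  exact_mod_cast h

end MeasureCore

end Summit.QuantumFields.YangMills.Theorems.CentreWallReflection.Slab

namespace Summit.QuantumFields.YangMills.Theorems.CentreWallReflection.Slab

open MeasureTheory
open Literature.MathematicalPhysics.QuantumFieldTheory.LatticeRP (splice measurePreserving_splice measurable_splice)
open Summit.QuantumFields.YangMills.Theorems.FemtoCurvatureTwoPointC (LatticeStokes.sub_re_trace_map_nonneg)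

section Kernels

variable {n : ℕ} {G : Type*} [Group G] [TopologicalSpace G] [IsTopologicalGroup G] [CompactSpace G]
  [MeasurableSpace G] [BorelSpace G] [SecondCountableTopology G] {N : ℕ} (ρ : G →* Matrix (Fin N) (Fin N) ℂ) (μ : Fin 4)

local notation "Ω" => GaugeConfig 4 (n + 1) G
local notation "πH" => (MeasureTheory.Measure.pi (fun _ : Edge 4 (n + 1) => haarProbability G))

/-! ## §8 Continuity and measurability -/

omit [CompactSpace G] [MeasurableSpace G] [BorelSpace G] [SecondCountableTopology G] in
/-- `continuous_plaquetteHolonomy` (slab bookkeeping, see the module docstring). -/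
theorem continuous_plaquetteHolonomy (x : Site 4 (n + 1)) (a b : Fin 4) :
    Continuous fun W : Ω => plaquetteHolonomy W x a b := by
  have h : ∀ e : Edge 4 (n + 1), Continuous fun W : Ω => W e := fun e => continuous_apply e
  unfold plaquetteHolonomy
  exact (((h _).mul (h _)).mul (h _).inv).mul (h _).inv

omit [CompactSpace G] [MeasurableSpace G] [BorelSpace G] [SecondCountableTopology G] in
/-- `continuous_plaqCost` (slab bookkeeping, see the module docstring). -/
theorem continuous_plaqCost (hρ : Continuous ρ) (p : Plaquette 4 (n + 1)) : Continuous fun W : Ω => plaqCost ρ W p :=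
  continuous_const.sub (Complex.continuous_re.comp (hρ.comp (continuous_plaquetteHolonomy p.1 _ _)).matrix_trace)

omit [CompactSpace G] [MeasurableSpace G] [BorelSpace G] [SecondCountableTopology G] in
/-- `continuous_slabAction` (slab bookkeeping, see the module docstring). -/
theorem continuous_slabAction (hρ : Continuous ρ) (j : ℕ) : Continuous fun W : Ω => slabAction ρ μ j W :=
  continuous_finsetSum _ fun p _ => continuous_const.mul (continuous_plaqCost ρ hρ p)

omit [CompactSpace G] [MeasurableSpace G] [BorelSpace G] [SecondCountableTopology G] in
/-- `continuous_coSlabAction` (slab bookkeeping, see the module docstring). -/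
theorem continuous_coSlabAction (hρ : Continuous ρ) (j : ℕ) : Continuous fun W : Ω => coSlabAction ρ μ j W :=
  continuous_finsetSum _ fun p _ => continuous_const.mul (continuous_plaqCost ρ hρ p)

omit [CompactSpace G] [MeasurableSpace G] [BorelSpace G] [SecondCountableTopology G] in
/-- `continuous_twistedCost` (slab bookkeeping, see the module docstring). -/
theorem continuous_twistedCost (hρ : Continuous ρ) (q : {p : Fin 4 × Fin 4 // p.1 < p.2}) (z : G) (p : Plaquette 4 (n + 1)) :
    Continuous fun W : Ω => twistedCost ρ q z W p :=
  continuous_const.sub (Complex.continuous_re.comp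
    (hρ.comp (continuous_const.mul (continuous_plaquetteHolonomy p.1 _ _))).matrix_trace)

omit [Group G] [IsTopologicalGroup G] [CompactSpace G] [MeasurableSpace G] [BorelSpace G] [SecondCountableTopology G] in
/-- `continuous_glue₃` (slab bookkeeping, see the module docstring). -/
theorem continuous_glue₃ (j : ℕ) : Continuous fun p : Ω × Ω × Ω => glue μ j p.1 p.2.1 p.2.2 := by
  refine continuous_pi fun e => ?_
  unfold glue
  split_ifs
  · exact (continuous_apply e).comp (continuous_fst.comp continuous_snd)
  · exact (continuous_apply _).comp (continuous_snd.comp continuous_snd)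
  · exact (continuous_apply e).comp continuous_fst

omit [TopologicalSpace G] [IsTopologicalGroup G] [CompactSpace G] [MeasurableSpace G] [BorelSpace G] [SecondCountableTopology G] in
/-- `plaqCost_nonneg` (slab bookkeeping, see the module docstring). -/
theorem plaqCost_nonneg (hU : ∀ g, ρ g ∈ Matrix.unitaryGroup (Fin N) ℂ) (W : Ω) (p : Plaquette 4 (n + 1)) : 0 ≤ plaqCost ρ W p :=
  LatticeStokes.sub_re_trace_map_nonneg ρ hU _

omit [TopologicalSpace G] [IsTopologicalGroup G] [CompactSpace G] [MeasurableSpace G] [BorelSpace G] [SecondCountableTopology G] in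
/-- `slabAction_nonneg` (slab bookkeeping, see the module docstring). -/
theorem slabAction_nonneg (hU : ∀ g, ρ g ∈ Matrix.unitaryGroup (Fin N) ℂ) (j : ℕ) (W : Ω) : 0 ≤ slabAction ρ μ j W :=
  Finset.sum_nonneg fun p _ => mul_nonneg (slabWeight_nonneg μ j p) (plaqCost_nonneg ρ hU W p)

omit [TopologicalSpace G] [IsTopologicalGroup G] [CompactSpace G] [MeasurableSpace G] [BorelSpace G] [SecondCountableTopology G] in
/-- `coSlabAction_nonneg` (slab bookkeeping, see the module docstring). -/
theorem coSlabAction_nonneg (hU : ∀ g, ρ g ∈ Matrix.unitaryGroup (Fin N) ℂ) (j : ℕ) (W : Ω) : 0 ≤ coSlabAction ρ μ j W :=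
  Finset.sum_nonneg fun p _ => mul_nonneg (sub_nonneg.mpr (slabWeight_le_one μ j p)) (plaqCost_nonneg ρ hU W p)

omit [Group G] [TopologicalSpace G] [IsTopologicalGroup G] [CompactSpace G] [MeasurableSpace G] [BorelSpace G]
  [SecondCountableTopology G] in
/-- `abs_exp_neg_le_one` (slab bookkeeping, see the module docstring). -/
theorem abs_exp_neg_le_one {β s : ℝ} (hβ : 0 ≤ β) (hs : 0 ≤ s) : |Real.exp (-(β * s))| ≤ 1 := by
  rw [abs_of_pos (Real.exp_pos _)]
  exact Real.exp_le_one_iff.mpr (by nlinarith)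

/-! ## §9 The slab kernels -/

omit [SecondCountableTopology G] in
/-- `slabKernel_nonneg` (slab bookkeeping, see the module docstring). -/
theorem slabKernel_nonneg (β : ℝ) (j : ℕ) (X A : Ω) : 0 ≤ slabKernel ρ μ β j X A :=
  integral_nonneg fun _ => (Real.exp_pos _).le

omit [SecondCountableTopology G] in
/-- `slabKernel_le_one` (slab bookkeeping, see the module docstring). -/
theorem slabKernel_le_one (hU : ∀ g, ρ g ∈ Matrix.unitaryGroup (Fin N) ℂ) {β : ℝ} (hβ : 0 ≤ β) (j : ℕ) (X A : Ω) :
    slabKernel ρ μ β j X A ≤ 1 := by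
  unfold slabKernel
  have h : ∫ U, Real.exp (-(β * slabAction ρ μ j (glue μ j U X A))) ∂πH ≤ ∫ U, (1 : ℝ) ∂πH := by
    refine integral_mono_of_nonneg (ae_of_all _ fun U => (Real.exp_pos _).le) (integrable_const _) (ae_of_all _ fun U => ?_)
    exact (le_abs_self _).trans (abs_exp_neg_le_one hβ (slabAction_nonneg ρ μ hU j _))
  simpa using h

omit [SecondCountableTopology G] in
/-- `abs_slabKernel_le_one` (slab bookkeeping, see the module docstring). -/
theorem abs_slabKernel_le_one (hU : ∀ g, ρ g ∈ Matrix.unitaryGroup (Fin N) ℂ) {β : ℝ} (hβ : 0 ≤ β) (j : ℕ) (X A : Ω) :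
    |slabKernel ρ μ β j X A| ≤ 1 := by
  rw [abs_of_nonneg (slabKernel_nonneg ρ μ β j X A)]; exact slabKernel_le_one ρ μ hU hβ j X A

/-- Measurability of the slab kernel along measurable arguments. -/
theorem measurable_slabKernel_comp (hρ : Continuous ρ) (β : ℝ) (j : ℕ) {α : Type*} [MeasurableSpace α]
    {f g : α → Ω} (hf : Measurable f) (hg : Measurable g) :
    Measurable fun a => slabKernel ρ μ β j (f a) (g a) := by
  unfold slabKernel
  have hc : Measurable fun q : α × Ω => Real.exp (-(β * slabAction ρ μ j (glue μ j q.2 (f q.1) (g q.1)))) := by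
    have h1 : Measurable fun q : α × Ω => glue μ j q.2 (f q.1) (g q.1) :=
      (measurable_glue₃ μ j).comp (measurable_snd.prodMk ((hf.comp measurable_fst).prodMk (hg.comp measurable_fst)))
    exact (Real.continuous_exp.measurable).comp ((((continuous_slabAction ρ μ hρ j).measurable.comp h1).const_mul β).neg)
  exact (hc.stronglyMeasurable.integral_prod_right' (ν := πH)).measurable

/-- `measurable_slabKernel_left` (slab bookkeeping, see the module docstring). -/
theorem measurable_slabKernel_left (hρ : Continuous ρ) (β : ℝ) (j : ℕ) (A : Ω) :
    Measurable fun X : Ω => slabKernel ρ μ β j X A :=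
  measurable_slabKernel_comp ρ μ hρ β j measurable_id measurable_const

/-- `measurable_slabKernel_right` (slab bookkeeping, see the module docstring). -/
theorem measurable_slabKernel_right (hρ : Continuous ρ) (β : ℝ) (j : ℕ) (X : Ω) :
    Measurable fun A : Ω => slabKernel ρ μ β j X A :=
  measurable_slabKernel_comp ρ μ hρ β j measurable_const measurable_id

/-- The complementary slab, glued and integrated, is the slab kernel `Ψ_{n+1−j}` with the boundary data exchanged. -/
theorem integral_exp_coSlabAction_glue (hρ : Continuous ρ) (β : ℝ) {j : ℕ} (hj1 : 1 ≤ j) (hjn : j ≤ n) (X A : Ω) :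
    ∫ U, Real.exp (-(β * coSlabAction ρ μ j (glue μ j U X A))) ∂πH = slabKernel ρ μ β (n + 1 - j) A X := by
  simp_rw [coSlabAction_eq_slabAction_translate ρ μ hj1 hjn, translate_glue μ hj1 hjn]
  exact integral_comp_mp (measurePreserving_translate μ (j : ZMod (n + 1)))
    (Φ := fun V : Ω => Real.exp (-(β * slabAction ρ μ (n + 1 - j) (glue μ (n + 1 - j) V A X))))
    ((Real.continuous_exp.measurable).comp (((continuous_slabAction ρ μ hρ _).measurable.comp
      (measurable_glue_left μ _ A X)).const_mul β).neg)

/-! ## §10 The ring identities -/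

omit [Group G] [TopologicalSpace G] [IsTopologicalGroup G] [CompactSpace G] [MeasurableSpace G] [BorelSpace G] [SecondCountableTopology G] in
/-- `dependsOn_comp` (slab bookkeeping, see the module docstring). -/
theorem dependsOn_comp {β γ : Type*} {f : Ω → β} {S : Set (Edge 4 (n + 1))} (hf : DependsOn f S) (g : β → γ) :
    DependsOn (fun W => g (f W)) S := fun _ _ h => congrArg g (hf h)

/-- **Ring identity (untwisted).** For a bounded measurable insertion `H` reading only the slices `0` and `j` (through `Hb`):
`∫ H e^{−β Σ_p c_p} dπ = ∫dX ∫dA Hb(X,A) Ψ_j(X,A) Ψ_{n+1−j}(A,X)`. -/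
theorem ring_identity (hρ : Continuous ρ) (hU : ∀ g, ρ g ∈ Matrix.unitaryGroup (Fin N) ℂ) {β : ℝ} (hβ : 0 ≤ β)
    {j : ℕ} (hj1 : 1 ≤ j) (hjn : j ≤ n) {H : Ω → ℝ} (hHm : Measurable H) {CH : ℝ} (hHb : ∀ W, |H W| ≤ CH)
    {Hb : Ω → Ω → ℝ} (hH : ∀ U X A, H (glue μ j U X A) = Hb X A) :
    ∫ W, H W * Real.exp (-(β * ∑ p : Plaquette 4 (n + 1), plaqCost ρ W p)) ∂πH =
      ∫ X, ∫ A, Hb X A * (slabKernel ρ μ β j X A * slabKernel ρ μ β (n + 1 - j) A X) ∂πH ∂πH := by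
  have hCH : 0 ≤ CH := (abs_nonneg _).trans (hHb 1)
  have hFm : Measurable fun W : Ω => H W * Real.exp (-(β * ∑ p : Plaquette 4 (n + 1), plaqCost ρ W p)) :=
    hHm.mul (Real.continuous_exp.measurable.comp
      ((continuous_finsetSum _ fun p _ => continuous_plaqCost ρ hρ p).measurable.const_mul β).neg)
  have hFb : ∀ W : Ω, |H W * Real.exp (-(β * ∑ p : Plaquette 4 (n + 1), plaqCost ρ W p))| ≤ CH := by
    intro W
    rw [abs_mul]
    have h1 : |Real.exp (-(β * ∑ p : Plaquette 4 (n + 1), plaqCost ρ W p))| ≤ 1 :=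
      abs_exp_neg_le_one hβ (Finset.sum_nonneg fun p _ => plaqCost_nonneg ρ hU W p)
    calc |H W| * |Real.exp (-(β * ∑ p, plaqCost ρ W p))| ≤ CH * 1 :=
          mul_le_mul (hHb W) h1 (abs_nonneg _) hCH
      _ = CH := mul_one _
  rw [integral_glue μ j hFm hFb]
  refine integral_congr_ae (ae_of_all _ fun X => integral_congr_ae (ae_of_all _ fun A => ?_))
  dsimp only
  -- split the action and factorise
  have hsplit : ∀ U : Ω, H (glue μ j U X A) * Real.exp (-(β * ∑ p : Plaquette 4 (n + 1), plaqCost ρ (glue μ j U X A) p)) =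
      Hb X A * (Real.exp (-(β * slabAction ρ μ j (glue μ j U X A))) * Real.exp (-(β * coSlabAction ρ μ j (glue μ j U X A)))) := by
    intro U
    rw [hH, ← slabAction_add_coSlabAction ρ μ j, mul_add, neg_add, Real.exp_add]
  simp_rw [hsplit]
  rw [integral_const_mul]
  congr 1
  rw [← integral_exp_coSlabAction_glue ρ μ hρ β hj1 hjn X A]
  refine integral_mul_of_dependsOn (slabInterior μ j) (coSlabEdges μ j) (disjoint_slabInterior_coSlabEdges μ j) ?_ ?_ ?_ ?_
  · exact Real.continuous_exp.measurable.comp ((((continuous_slabAction ρ μ hρ j).measurable.comp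
      (measurable_glue_left μ j X A)).const_mul β).neg)
  · exact Real.continuous_exp.measurable.comp ((((continuous_coSlabAction ρ μ hρ j).measurable.comp
      (measurable_glue_left μ j X A)).const_mul β).neg)
  · have h := dependsOn_glue_of_dependsOn μ (dependsOn_comp (dependsOn_slabAction ρ μ hjn) fun s => Real.exp (-(β * s))) j X A
    exact h.mono (by exact_mod_cast slabEdges_filter_subset_interior μ j)
  · have h := dependsOn_glue_of_dependsOn μ (dependsOn_comp (dependsOn_coSlabAction ρ μ j) fun s => Real.exp (-(β * s))) j X A
    exact h.mono (by exact_mod_cast coSlabEdges_filter_subset (μ := μ) (j := j))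

end Kernels

end Summit.QuantumFields.YangMills.Theorems.CentreWallReflection.Slab

end
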